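import Literature.Probability.Percolation.RegionGluing
import Literature.Probability.Percolation.BoundaryDecay
import Literature.Probability.Percolation.HalfSpaceProofs
import Literature.Probability.Percolation.ContinuityCriterion
import Literature.Probability.Percolation.CubicCriticalProbHalfProofs
import Literature.Probability.Percolation.GrimmettMarstrand
import Literature.Probability.Percolation.ConstrainedClusters
import Literature.Probability.Percolation.SubgraphMonotonicity
import Literature.Probability.Percolation.SiteConnectionTools
import Literature.Probability.Percolation.BondPercolationSymmetry
import HarnessLib
import Mathlib.MeasureTheory.Integral.Indicator
import Mathlib.Analysis.SpecificLimits.Basic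
import Mathlib.Analysis.PSeries

/-!
# Sparsely attached fins: regions strictly above the half-space with `θ(p_c(ℤ³)) = 0` (part 1/4)

Problem-side theorems of the seat `solo-CriticalPhenomena-blind` toward `PercolationContinuityZ3`
(`θ(p_c) = 0` on `ℤ³`).  ENGINE (landed): `Literature.Probability.Percolation.RegionGluing`
(BGN at every root / coordinate half-space, wall recurrence, the deterministic one-sided two-region
finiteness criterion `finite_openClusterIn_union`, plane transport + exponential decay of in-plane
connections at `p_c(ℤ³) < 1/2`) and `Literature.Probability.Percolation.BoundaryDecay`
(connector connection probabilities inside `ℍ` tend to zero; greedy sparse connector sets).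
Reformulations / ladders: `Literature.Probability.Percolation.ContinuityZ3Ladder`.
Sources: Grimmett, *Percolation* (2nd ed. 1999), Thm. (7.35) p. 162, Thm. (5.4) p. 88,
Thm. (11.11) p. 287; Barsky–Grimmett–Newman, PTRF 90 (1991) 111–148.

This file: `ae_sparseFin_openClusterIn_finite`, `theta_induce_sparseFin_criticalProbI_eq_zero` — the
half-space `ℍ = {0 ≤ x₀}` with the planar fin `{x₁ = 0, x₀ ≤ -2}` attached through connector sites
`(-1, 0, z)`, `z ∈ Z`: if the connectors have summable pairwise connection probabilities inside `ℍ`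
at `p_c(ℤ³)` then `θ(p_c(ℤ³)) = 0` at every root (BGN both sides + first Borel–Cantelli + the
deterministic criterion); and the FIN-SIDE version
`theta_induce_sparseFin_criticalProbI_eq_zero_of_finSide` (it suffices that the connector FEET
have summable pairwise connection probabilities inside the lower half-plane `{x₁ = 0, x₀ ≤ -1}`,
a planar event at `p_c(ℤ³) < 1/2`).  For `Z = ℤ` the region is the open "fin rung".
-/

noncomputable section

namespace Summit.CriticalPhenomena.PercolationContinuityZ3.Theorems

open MeasureTheory Literature.Probability.Percolation Literature.Probability.LatticeModels
open Literature.Probability.Percolation.RegionGluing Literature.Probability.Percolation.BoundaryDecay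


/-! ### Sparsely attached fins: the almost-sure statement

`S_Z = ℍ ∪ {x | x₁ = 0 ∧ x₀ ≤ -2} ∪ {x | x₁ = 0 ∧ x₀ = -1 ∧ x₂ ∈ Z}` is the half-space with the
half-plane fin `{x₁ = 0, x₀ < 0}` held one unit away and re-attached through the connector sites
`(-1, 0, z)`, `z ∈ Z` (so `S_ℤ = ℍ ∪ fin`).  Its two regions `ℍ` and the detached fin lie in the
coordinate half-spaces `{0 ≤ x₀}` and `{x₀ ≤ -1}`, so at `p_c` all their pieces are finite almost
surely (`ae_forall_not_percolatesVia_coordHalfSpace`), and the deterministic criterion applies: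
almost surely, for EVERY `Z`, if only finitely many pairs of distinct connectors are joined inside
`ℍ`, then no cluster inside `S_Z` is infinite.  Under
`Σ_{z ≠ z' ∈ Z} P_{p_c}((0,0,z) ↔ (0,0,z') in ℍ) < ∞` the hypothesis holds
almost surely by the first-moment Borel–Cantelli lemma, and since BGN gives
`P_{p_c}((0,0,0) ↔ (0,0,r) in ℍ) → 0`, sufficiently sparse infinite `Z` qualify: there are regions
of `ℤ³` containing `ℍ` together with an infinite planar sheet attached at infinitely many points,
contained in no half-space, without percolation at `p_c` (see the session's `wall.md` §5(i)). -/

/-- Cross edges between `ℍ = {0 ≤ x₀}` and `{x₀ ≤ -1}` are the edges `(b + e₀, b)`. -/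
theorem eq_add_single_of_zdGraph_adj_of_nonneg_of_le {a b : Site 3} (ha : 0 ≤ a 0) (hb : b 0 ≤ -1)
    (h : (zdGraph 3).Adj a b) : a = b + Pi.single 0 1 := by
  obtain ⟨j, hj | hj⟩ := (zdGraph_adj_iff a b).1 h
  · exfalso
    have := congrArg (fun f : Site 3 => f 0) hj
    simp only [Pi.add_apply] at this
    rcases eq_or_ne (0 : Fin 3) j with rfl | h0j
    · simp only [Pi.single_eq_same] at this; omega
    · simp only [Pi.single_eq_of_ne h0j] at this; omega
  · rcases eq_or_ne (0 : Fin 3) j with rfl | h0j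
    · exact hj
    · exfalso
      have := congrArg (fun f : Site 3 => f 0) hj
      simp only [Pi.add_apply, Pi.single_eq_of_ne h0j] at this; omega

/-- **Sparsely attached fins, almost surely.** `P_{p_c}`-a.s. on `ℤ³`, for every `Z ⊆ ℤ`: if only
finitely many cross edges of `S_Z` have a distinct partner cross edge in the same `ℍ`-piece, then
every open cluster computed inside `S_Z` is finite. -/
theorem ae_sparseFin_openClusterIn_finite :
    ∀ᵐ ω ∂(bondPercolation (zdGraph 3) (criticalProbI 3)), ∀ Z : Set ℤ,
      {e : Site 3 × Site 3 |
          (e.1 ∈ {x : Site 3 | 0 ≤ x 0} ∧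
            e.2 ∈ {x : Site 3 | (x 1 = 0 ∧ x 0 ≤ -2) ∨ (x 1 = 0 ∧ x 0 = -1 ∧ x 2 ∈ Z)} ∧
            (zdGraph 3).Adj e.1 e.2) ∧
          ∃ e' : Site 3 × Site 3,
            (e'.1 ∈ {x : Site 3 | 0 ≤ x 0} ∧
              e'.2 ∈ {x : Site 3 | (x 1 = 0 ∧ x 0 ≤ -2) ∨ (x 1 = 0 ∧ x 0 = -1 ∧ x 2 ∈ Z)} ∧
              (zdGraph 3).Adj e'.1 e'.2) ∧ e' ≠ e ∧
            e'.1 ∈ openClusterIn (withinGraph (zdGraph 3) {x : Site 3 | 0 ≤ x 0}) ω e.1}.Finite →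
      ∀ x : Site 3, (openClusterIn (withinGraph (zdGraph 3)
          ({x : Site 3 | 0 ≤ x 0} ∪
            {x : Site 3 | (x 1 = 0 ∧ x 0 ≤ -2) ∨ (x 1 = 0 ∧ x 0 = -1 ∧ x 2 ∈ Z)})) ω x).Finite := by
  filter_upwards [ae_forall_not_percolatesVia_coordHalfSpace] with ω hH Z hDA x
  have hAB : Disjoint ({x : Site 3 | 0 ≤ x 0})
      {x : Site 3 | (x 1 = 0 ∧ x 0 ≤ -2) ∨ (x 1 = 0 ∧ x 0 = -1 ∧ x 2 ∈ Z)} := by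
    rw [Set.disjoint_left]
    rintro v (hv : 0 ≤ v 0) (⟨_, h⟩ | ⟨_, h, _⟩) <;> omega
  have hBle : {x : Site 3 | (x 1 = 0 ∧ x 0 ≤ -2) ∨ (x 1 = 0 ∧ x 0 = -1 ∧ x 2 ∈ Z)} ⊆
      {x : Site 3 | x 0 ≤ -1} := by
    rintro v (⟨_, h⟩ | ⟨_, h, _⟩) <;> simp only [Set.mem_setOf_eq] <;> omega
  refine finite_openClusterIn_union hAB ?_ ?_ ?_ ?_ hDA x
  · intro u v v' hu hv hv' huv huv'
    have h1 := eq_add_single_of_zdGraph_adj_of_nonneg_of_le hu (hBle hv) huv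
    have h2 := eq_add_single_of_zdGraph_adj_of_nonneg_of_le hu (hBle hv') huv'
    exact add_right_cancel (h1.symm.trans h2)
  · intro u u' v hu hu' hv huv hu'v
    have h1 := eq_add_single_of_zdGraph_adj_of_nonneg_of_le hu (hBle hv) huv
    have h2 := eq_add_single_of_zdGraph_adj_of_nonneg_of_le hu' (hBle hv) hu'v
    exact h1.trans h2.symm
  · intro u
    exact Set.not_infinite.1 (hH 0 0 u).1
  · intro v
    refine Set.not_infinite.1 fun hinf => (hH 0 (-1) v).2 ?_
    exact hinf.mono (openClusterIn_mono_graph (withinGraph_mono _ hBle) ω v)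

/-- The cross edges of `S_Z` are exactly `((0,0,z), (-1,0,z))`, `z ∈ Z`. -/
theorem sparseFin_crossEdge_eq {Z : Set ℤ} {e : Site 3 × Site 3}
    (he : e.1 ∈ {x : Site 3 | 0 ≤ x 0} ∧
      e.2 ∈ {x : Site 3 | (x 1 = 0 ∧ x 0 ≤ -2) ∨ (x 1 = 0 ∧ x 0 = -1 ∧ x 2 ∈ Z)} ∧
      (zdGraph 3).Adj e.1 e.2) :
    e.2 2 ∈ Z ∧ e.1 = Function.update (0 : Site 3) 2 (e.2 2) ∧
      e.2 = Function.update (0 : Site 3) 2 (e.2 2) - Pi.single 0 1 := by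
  obtain ⟨h1, h2, hadj⟩ := he
  have h1' : 0 ≤ e.1 0 := h1
  have hle : e.2 0 ≤ -1 := by
    rcases h2 with ⟨_, h⟩ | ⟨_, h, _⟩
    · omega
    · omega
  have hmate := eq_add_single_of_zdGraph_adj_of_nonneg_of_le h1' hle hadj
  have h0 : e.1 0 = e.2 0 + 1 := by
    have := congrArg (fun f : Site 3 => f 0) hmate
    simpa using this
  have hcoord : ∀ i, i ≠ (0 : Fin 3) → e.1 i = e.2 i := by
    intro i hi
    have := congrArg (fun f : Site 3 => f i) hmate
    simpa [Pi.single_eq_of_ne hi] using this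
  rcases h2 with ⟨_, h⟩ | ⟨h21, h20, h2Z⟩
  · exfalso; omega
  have hA : e.1 = Function.update (0 : Site 3) 2 (e.2 2) := by
    funext i
    match i with
    | 0 => rw [Function.update_of_ne (by decide), Pi.zero_apply]; omega
    | 1 => rw [Function.update_of_ne (by decide), Pi.zero_apply, hcoord 1 (by decide)]; exact h21
    | 2 => rw [Function.update_self, hcoord 2 (by decide)]
  refine ⟨h2Z, hA, ?_⟩
  rw [← hA, hmate, add_sub_cancel_right]

/-- **No percolation at `p_c` in a half-space with a sparsely attached fin (C12).**  If the
connector sites `(0,0,z)`, `z ∈ Z`, have summable pairwise connection probabilities inside `ℍ`,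
then `θ(p_c) = 0` at every root of `S_Z = ℍ ∪ {x₁ = 0, x₀ ≤ -2} ∪ {(-1,0,z) : z ∈ Z}`
(as an induced subgraph of `ℤ³`).  Ingredients: BGN in every coordinate half-space, the first
Borel–Cantelli lemma, and the deterministic criterion `finite_openClusterIn_union`. -/
theorem theta_induce_sparseFin_criticalProbI_eq_zero (Z : Set ℤ)
    (hA : ∑' q : {q : ℤ × ℤ // q.1 ∈ Z ∧ q.2 ∈ Z ∧ q.1 ≠ q.2},
        (bondPercolation (zdGraph 3) (criticalProbI 3))
          (openConnVia (withinGraph (zdGraph 3) {x : Site 3 | 0 ≤ x 0})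
            (Function.update (0 : Site 3) 2 q.1.1) (Function.update (0 : Site 3) 2 q.1.2)) ≠ ⊤)
    (x : Site 3)
    (hx : x ∈ {x : Site 3 | 0 ≤ x 0} ∪
      {x : Site 3 | (x 1 = 0 ∧ x 0 ≤ -2) ∨ (x 1 = 0 ∧ x 0 = -1 ∧ x 2 ∈ Z)}) :
    theta ((zdGraph 3).induce ({x : Site 3 | 0 ≤ x 0} ∪
      {x : Site 3 | (x 1 = 0 ∧ x 0 ≤ -2) ∨ (x 1 = 0 ∧ x 0 = -1 ∧ x 2 ∈ Z)})) ⟨x, hx⟩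
      (criticalProbI 3) = 0 := by
  rw [theta_induce_eq_real_percolatesVia]
  refine (measureReal_eq_zero_iff (measure_ne_top _ _)).2 (measure_eq_zero_iff_ae_notMem.2 ?_)
  filter_upwards [ae_sparseFin_openClusterIn_finite, MeasureTheory.ae_finite_setOf_mem hA]
    with ω hω hfA
  intro hperc
  refine hperc (hω Z ?_ x)
  · -- ℍ-side double cross edges inject into the finitely many connected connector pairs
    refine (hfA.image fun q : {q : ℤ × ℤ // q.1 ∈ Z ∧ q.2 ∈ Z ∧ q.1 ≠ q.2} =>
      ((Function.update (0 : Site 3) 2 q.1.1, Function.update (0 : Site 3) 2 q.1.1 - Pi.single 0 1)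
        : Site 3 × Site 3)).subset ?_
    rintro e ⟨he, e', he', hne, hconn⟩
    obtain ⟨hz, h1, h2⟩ := sparseFin_crossEdge_eq he
    obtain ⟨hz', h1', h2'⟩ := sparseFin_crossEdge_eq he'
    have hzz : e.2 2 ≠ e'.2 2 := by
      intro h
      apply hne
      refine Prod.ext ?_ ?_
      · rw [h1', h1, h]
      · rw [h2', h2, h]
    refine ⟨⟨(e.2 2, e'.2 2), hz, hz', hzz⟩, ?_, ?_⟩
    · show Function.update (0 : Site 3) 2 (e'.2 2) ∈ openClusterIn _ ω (Function.update (0 : Site 3) 2 (e.2 2))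
      rw [← h1, ← h1']; exact hconn
    · exact Prod.ext h1.symm h2.symm

/-! ### Sparse fins, fin-side version: the planar side carries the estimate

The criterion `finite_openClusterIn_union` is one-sided, and for the fin the OTHER side is the
profitable one: taking `A =` the detached fin and `B = ℍ`, it suffices that only finitely many
pairs of distinct connector feet `(-1,0,z)`, `(-1,0,z')`, `z, z' ∈ Z`, are joined inside the lower
half-plane `P⁻ = {x₁ = 0, x₀ ≤ -1}`.  Planar percolation at `p_c(ℤ³) < 1/2 = p_c(ℤ²)` is
subcritical, so these connection probabilities decay EXPONENTIALLY in `|z - z'|` (sharpness,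
`perc_sharpness`, proved in the tree as `DCT16.perc_sharpness_holds`, with
`kesten_criticalProb_Z3_lt_half_holds` and Kesten's `p_c(ℤ²) = 1/2`); consequently EXPLICIT
attachment sets with gaps `≥ C log j` — e.g. `Z = {j²}` — satisfy the hypothesis below (the routine
transport plane-of-`ℤ³` ≅ `ℤ²` is not carried out here).  Bounded gaps (`Z = kℤ`) remain open. -/

/-- **Sparse fins, fin-side hypothesis, almost surely.** `P_{p_c}`-a.s., for every `Z ⊆ ℤ`: if
only finitely many cross edges of `S_Z` have a distinct partner cross edge in the same FIN piece,
then every open cluster computed inside `S_Z` is finite. -/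
theorem ae_sparseFin_openClusterIn_finite_finSide :
    ∀ᵐ ω ∂(bondPercolation (zdGraph 3) (criticalProbI 3)), ∀ Z : Set ℤ,
      {e : Site 3 × Site 3 |
          (e.1 ∈ {x : Site 3 | (x 1 = 0 ∧ x 0 ≤ -2) ∨ (x 1 = 0 ∧ x 0 = -1 ∧ x 2 ∈ Z)} ∧
            e.2 ∈ {x : Site 3 | 0 ≤ x 0} ∧ (zdGraph 3).Adj e.1 e.2) ∧
          ∃ e' : Site 3 × Site 3,
            (e'.1 ∈ {x : Site 3 | (x 1 = 0 ∧ x 0 ≤ -2) ∨ (x 1 = 0 ∧ x 0 = -1 ∧ x 2 ∈ Z)} ∧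
              e'.2 ∈ {x : Site 3 | 0 ≤ x 0} ∧ (zdGraph 3).Adj e'.1 e'.2) ∧ e' ≠ e ∧
            e'.1 ∈ openClusterIn (withinGraph (zdGraph 3)
              {x : Site 3 | (x 1 = 0 ∧ x 0 ≤ -2) ∨ (x 1 = 0 ∧ x 0 = -1 ∧ x 2 ∈ Z)}) ω e.1}.Finite →
      ∀ x : Site 3, (openClusterIn (withinGraph (zdGraph 3)
          ({x : Site 3 | 0 ≤ x 0} ∪
            {x : Site 3 | (x 1 = 0 ∧ x 0 ≤ -2) ∨ (x 1 = 0 ∧ x 0 = -1 ∧ x 2 ∈ Z)})) ω x).Finite := by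
  filter_upwards [ae_forall_not_percolatesVia_coordHalfSpace] with ω hH Z hDA x
  have hAB : Disjoint {x : Site 3 | (x 1 = 0 ∧ x 0 ≤ -2) ∨ (x 1 = 0 ∧ x 0 = -1 ∧ x 2 ∈ Z)}
      ({x : Site 3 | 0 ≤ x 0}) := by
    rw [Set.disjoint_left]
    rintro v (⟨_, h⟩ | ⟨_, h, _⟩) (hv : 0 ≤ v 0) <;> omega
  have hAle : {x : Site 3 | (x 1 = 0 ∧ x 0 ≤ -2) ∨ (x 1 = 0 ∧ x 0 = -1 ∧ x 2 ∈ Z)} ⊆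
      {x : Site 3 | x 0 ≤ -1} := by
    rintro v (⟨_, h⟩ | ⟨_, h, _⟩) <;> simp only [Set.mem_setOf_eq] <;> omega
  have h := finite_openClusterIn_union hAB ?_ ?_ ?_ ?_ hDA x
  · rwa [Set.union_comm] at h
  · intro u v v' hu hv hv' huv huv'
    have h1 := eq_add_single_of_zdGraph_adj_of_nonneg_of_le hv (hAle hu) huv.symm
    have h2 := eq_add_single_of_zdGraph_adj_of_nonneg_of_le hv' (hAle hu) huv'.symm
    exact h1.trans h2.symm
  · intro u u' v hu hu' hv huv hu'v
    have h1 := eq_add_single_of_zdGraph_adj_of_nonneg_of_le hv (hAle hu) huv.symm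
    have h2 := eq_add_single_of_zdGraph_adj_of_nonneg_of_le hv (hAle hu') hu'v.symm
    exact add_right_cancel (h1.symm.trans h2)
  · intro u
    refine Set.not_infinite.1 fun hinf => (hH 0 (-1) u).2 ?_
    exact hinf.mono (openClusterIn_mono_graph (withinGraph_mono _ hAle) ω u)
  · intro v
    exact Set.not_infinite.1 (hH 0 0 v).1

/-- **No percolation at `p_c` in a half-space with a sparsely attached fin — fin-side criterion.**
If the connector FEET `(-1,0,z)`, `z ∈ Z`, have summable pairwise connection probabilities inside
the lower half-plane `P⁻ = {x₁ = 0, x₀ ≤ -1}` (planar, subcritical at `p_c(ℤ³) < 1/2`), then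
`θ(p_c) = 0` at every root of `S_Z`. -/
theorem theta_induce_sparseFin_criticalProbI_eq_zero_of_finSide (Z : Set ℤ)
    (hB : ∑' q : {q : ℤ × ℤ // q.1 ∈ Z ∧ q.2 ∈ Z ∧ q.1 ≠ q.2},
        (bondPercolation (zdGraph 3) (criticalProbI 3))
          (openConnVia (withinGraph (zdGraph 3) {x : Site 3 | x 1 = 0 ∧ x 0 ≤ -1})
            (Function.update (0 : Site 3) 2 q.1.1 - Pi.single 0 1)
            (Function.update (0 : Site 3) 2 q.1.2 - Pi.single 0 1)) ≠ ⊤)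
    (x : Site 3)
    (hx : x ∈ {x : Site 3 | 0 ≤ x 0} ∪
      {x : Site 3 | (x 1 = 0 ∧ x 0 ≤ -2) ∨ (x 1 = 0 ∧ x 0 = -1 ∧ x 2 ∈ Z)}) :
    theta ((zdGraph 3).induce ({x : Site 3 | 0 ≤ x 0} ∪
      {x : Site 3 | (x 1 = 0 ∧ x 0 ≤ -2) ∨ (x 1 = 0 ∧ x 0 = -1 ∧ x 2 ∈ Z)})) ⟨x, hx⟩
      (criticalProbI 3) = 0 := by
  rw [theta_induce_eq_real_percolatesVia]
  refine (measureReal_eq_zero_iff (measure_ne_top _ _)).2 (measure_eq_zero_iff_ae_notMem.2 ?_)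
  filter_upwards [ae_sparseFin_openClusterIn_finite_finSide, MeasureTheory.ae_finite_setOf_mem hB]
    with ω hω hfB
  intro hperc
  refine hperc (hω Z ?_ x)
  have hsub : {x : Site 3 | (x 1 = 0 ∧ x 0 ≤ -2) ∨ (x 1 = 0 ∧ x 0 = -1 ∧ x 2 ∈ Z)} ⊆
      {x : Site 3 | x 1 = 0 ∧ x 0 ≤ -1} := by
    rintro v (⟨h1, h0⟩ | ⟨h1, h0, _⟩)
    · exact ⟨h1, by omega⟩
    · exact ⟨h1, by omega⟩
  refine (hfB.image fun q : {q : ℤ × ℤ // q.1 ∈ Z ∧ q.2 ∈ Z ∧ q.1 ≠ q.2} =>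
    ((Function.update (0 : Site 3) 2 q.1.1 - Pi.single 0 1, Function.update (0 : Site 3) 2 q.1.1)
      : Site 3 × Site 3)).subset ?_
  rintro e ⟨he, e', he', hne, hconn⟩
  obtain ⟨hz, h2, h1⟩ := sparseFin_crossEdge_eq (Z := Z) (e := (e.2, e.1)) ⟨he.2.1, he.1, he.2.2.symm⟩
  obtain ⟨hz', h2', h1'⟩ :=
    sparseFin_crossEdge_eq (Z := Z) (e := (e'.2, e'.1)) ⟨he'.2.1, he'.1, he'.2.2.symm⟩
  simp only at hz h2 h1 hz' h2' h1'
  have hzz : e.1 2 ≠ e'.1 2 := by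
    intro h
    apply hne
    refine Prod.ext ?_ ?_
    · rw [h1', h1, h]
    · rw [h2', h2, h]
  refine ⟨⟨(e.1 2, e'.1 2), hz, hz', hzz⟩, ?_, ?_⟩
  · show Function.update (0 : Site 3) 2 (e'.1 2) - Pi.single 0 1 ∈
      openClusterIn _ ω (Function.update (0 : Site 3) 2 (e.1 2) - Pi.single 0 1)
    rw [← h1, ← h1']
    exact openClusterIn_mono_graph (withinGraph_mono _ hsub) ω _ hconn
  · exact Prod.ext h1.symm h2.symm

end Summit.CriticalPhenomena.PercolationContinuityZ3.Theorems
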